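import Summits.RiemannHypothesis.RiemannHypothesis.Theorems.SemilocalSoninMollify
import HarnessLib

/-!
# The semilocal operator obligation: refutation from a bounded (non-smooth) witness, limit form

Cell `rh-explicit`, seat cc-s2-1 (HOME `run/shared/lean/pub/rh-explicit/`; lead ruling R5-1, PHASE 2 inputs).  Third of
the seat's PHASE-2 files: `SemilocalSoninNearVector` (bridge for a SMOOTH test function), `SemilocalSoninMollify`
(mollifications `g_k = G ⋆ φ_k` of a bounded witness `G`: Weil tests, moments multiplicative, Sonin term converges),
and this file, which puts the two together so that the assembly file of seat cc-s2-3 (E8) is pure arithmetic: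

**`not_semilocalSoninIneqOn_of_bdd_witness`.**  Let `G` be measurable, `|G| ≤ M`, `G = 0` off `[−b, b]` (`0 ≤ b < a`),
continuous a.e., with CC's two moment conditions `mulFourier G (I/2) = 0 = mulFourier G 0`; `k_G = G ⋆ G̃`.  Let
`ζ ∈ S(1,1)` with `‖η − ζ‖ ≤ d < ‖η‖`, and real data `B ≤ Re⟨η|ϑ(T_p k_G)η⟩`, `‖θ_pη‖² ≤ Gm`, `‖η‖ ≤ N`,
`‖T_p k_G‖_{L¹} < K`, `0 ≤ C` with `Re(W_∞ − W_p)(g_k ⋆ g̃_k) ≤ C` for all large `k` (the Weil side along the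
mollifications — seat cc-s2-4/cc-s2-3's E5), and `C·(Gm + 4(2N + d)d) < B − K(2N + d)d`.  Then
`¬ SemilocalSoninIneqOn p a`.  (Proof: along `g_k` the Sonin term tends to `Re⟨η|ϑ(T_p k_G)η⟩ ≥ B` and
`‖T_p(g_k⋆g̃_k)‖₁ → ‖T_p k_G‖₁ < K`; for `k` large `g_k` is a Weil test on `[−a, a]` with CC's conditions, and the
smooth bridge `not_semilocalSoninIneqOn_of_near_vector` applies with half the slack.)
`not_semilocalSoninIneqOn_of_bdd_witness_nearSonin`: the same with `ζ` supplied by the distance lemma from a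
band-energy bound (`hband`, `ε/(1 − Λ) ≤ d²`).

Proof-only file (no definitions, no named facts). [folklore]
-/

set_option linter.dupNamespace false  -- the mandated namespace repeats `RiemannHypothesis`

noncomputable section

open MeasureTheory Complex Set Filter Topology FourierTransform
open scoped Real ComplexConjugate ENNReal

namespace Summit.RiemannHypothesis.RiemannHypothesis

open Literature.NumberTheory.LFunctions Literature.NumberTheory.LFunctions.WeilContinuous
  Literature.NumberTheory.ConnesConsani2021

section Limit

variable (p : ℕ) [hp : Fact p.Prime] {G : ℝ → ℂ} {b M : ℝ}

omit hp in
/-- `‖T_p(g_k ⋆ g̃_k) − T_p(G ⋆ G̃)‖_{L¹} → 0` along the mollifications `g_k = G ⋆ φ_k`. [folklore] -/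
theorem tendsto_integral_norm_twistKernel_moll_sub (hGm : Measurable G) (hM : ∀ x, ‖G x‖ ≤ M)
    (hGb : ∀ x, b < |x| → G x = 0) (hb : 0 ≤ b) (hGc : ∀ᵐ x : ℝ, ContinuousAt G x) :
    Tendsto (fun k : ℕ ↦ ∫ τ, ‖twistKernel p (weilConv (weilConv G (moll k)) (weilReflect (weilConv G (moll k)))) τ
        - twistKernel p (weilConv G (weilReflect G)) τ‖) atTop (𝓝 0) := by
  have hM0 := bound_nonneg_of_bdd hM
  have hGi : Integrable G := integrable_of_bdd hGm hM hGb
  have hkG : Integrable (weilConv G (weilReflect G)) := by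
    unfold weilConv
    exact hGi.integrable_convolution (ContinuousLinearMap.mul ℂ ℂ) (Theorems.PfPersistence.integrable_weilReflect hGi)
  have hkk : ∀ k : ℕ, Integrable (weilConv (weilConv G (moll k)) (weilReflect (weilConv G (moll k)))) := fun k ↦
    integrable_weilConv_weilReflect (isWeilTest_weilConv_moll_of_bdd hGm hM hGb k)
  set c : ℝ := (1 + (p : ℝ)⁻¹ + 2 * Real.exp (-(Real.log p / 2))) with hc
  have hc0 : 0 ≤ c := by positivity
  have hbound : ∀ k : ℕ,
      ∫ τ, ‖twistKernel p (weilConv (weilConv G (moll k)) (weilReflect (weilConv G (moll k)))) τ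
        - twistKernel p (weilConv G (weilReflect G)) τ‖
      ≤ c * (8 * (b + 1) * M) * ∫ x, ‖weilConv G (moll k) x - G x‖ := fun k ↦ by
    have hlin : ∀ τ, twistKernel p (weilConv (weilConv G (moll k)) (weilReflect (weilConv G (moll k)))) τ
        - twistKernel p (weilConv G (weilReflect G)) τ
        = twistKernel p (weilConv (weilConv G (moll k)) (weilReflect (weilConv G (moll k)))
            - weilConv G (weilReflect G)) τ := fun τ ↦ by
      simp only [twistKernel, Pi.sub_apply]; ring
    simp_rw [hlin]
    calc _ ≤ c * ∫ τ, ‖weilConv (weilConv G (moll k)) (weilReflect (weilConv G (moll k))) τ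
          - weilConv G (weilReflect G) τ‖ := integral_norm_twistKernel_le p ((hkk k).sub hkG)
      _ ≤ c * (8 * (b + 1) * M * ∫ x, ‖weilConv G (moll k) x - G x‖) :=
          mul_le_mul_of_nonneg_left (integral_norm_kernel_moll_sub_le hGm hM hGb hb k) hc0
      _ = _ := by ring
  have hlim : Tendsto (fun k : ℕ ↦ c * (8 * (b + 1) * M) * ∫ x, ‖weilConv G (moll k) x - G x‖)
      atTop (𝓝 0) := by
    have h := (tendsto_integral_norm_weilConv_moll_sub hGm hM hGb hGc).const_mul (c * (8 * (b + 1) * M))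
    rwa [mul_zero] at h
  exact squeeze_zero (fun _ ↦ integral_nonneg fun _ ↦ norm_nonneg _) hbound hlim

/-- **Refutation of `SemilocalSoninIneqOn p a` from a bounded (non-smooth) witness and a Sonin vector near `η`**
(limit form of `not_semilocalSoninIneqOn_of_near_vector` along the mollifications `g_k = G ⋆ φ_k`; see the module
docstring for the list of data). [folklore] -/
theorem not_semilocalSoninIneqOn_of_bdd_witness {a : ℝ} (hGm : Measurable G) (hM : ∀ x, ‖G x‖ ≤ M)
    (hGb : ∀ x, b < |x| → G x = 0) (hb : 0 ≤ b) (hab : b < a) (hGc : ∀ᵐ x : ℝ, ContinuousAt G x)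
    (h1 : mulFourier G (I / 2) = 0) (h0 : mulFourier G 0 = 0)
    {η ζ : Lp ℂ 2 (volume : Measure ℝ)} (hζ : ζ ∈ soninSpace 1 1)
    {d B Gm N C K : ℝ} (hd : ‖η - ζ‖ ≤ d) (hdη : d < ‖η‖)
    (hB : B ≤ (soninTraceForm (twistKernel p (weilConv G (weilReflect G))) (η : ℝ → ℂ)).re)
    (hG : ‖primeTwist p η‖ ^ 2 ≤ Gm) (hN : ‖η‖ ≤ N)
    (hC : ∀ᶠ k : ℕ in atTop, (archW (weilConv (weilConv G (moll k)) (weilReflect (weilConv G (moll k))))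
      - weilSemilocalPrimeTerm {p} (weilConv (weilConv G (moll k)) (weilReflect (weilConv G (moll k))))).re ≤ C)
    (hC0 : 0 ≤ C)
    (hK : ∫ τ, ‖twistKernel p (weilConv G (weilReflect G)) τ‖ < K)
    (hineq : C * (Gm + 4 * ((2 * N + d) * d)) < B - K * ((2 * N + d) * d)) :
    ¬ SemilocalSoninIneqOn p a := by
  -- the slack
  set s : ℝ := (B - K * ((2 * N + d) * d)) - C * (Gm + 4 * ((2 * N + d) * d)) with hs
  have hs0 : 0 < s := by rw [hs]; linarith
  -- (i) the Sonin term along `g_k` is eventually within `s/2` of its limit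
  have hT := tendsto_soninTraceForm_twistKernel_moll p hGm hM hGb hb hGc η
  have e1 : ∀ᶠ k : ℕ in atTop, ‖soninTraceForm (twistKernel p
      (weilConv (weilConv G (moll k)) (weilReflect (weilConv G (moll k))))) (η : ℝ → ℂ)
      - soninTraceForm (twistKernel p (weilConv G (weilReflect G))) (η : ℝ → ℂ)‖ < s / 2 := by
    have h := (tendsto_iff_norm_sub_tendsto_zero.mp hT)
    exact (h.eventually (gt_mem_nhds (by positivity : (0 : ℝ) < s / 2)))
  -- (ii) the twisted kernels' `L¹` norms are eventually `≤ K`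
  have e2 : ∀ᶠ k : ℕ in atTop,
      ∫ τ, ‖twistKernel p (weilConv (weilConv G (moll k)) (weilReflect (weilConv G (moll k)))) τ‖ ≤ K := by
    have hgap : 0 < K - ∫ τ, ‖twistKernel p (weilConv G (weilReflect G)) τ‖ := by linarith
    have h := (tendsto_integral_norm_twistKernel_moll_sub p hGm hM hGb hb hGc).eventually
      (gt_mem_nhds hgap)
    filter_upwards [h] with k hk
    have hGi : Integrable G := integrable_of_bdd hGm hM hGb
    have hkG : Integrable (twistKernel p (weilConv G (weilReflect G))) := by
      refine integrable_twistKernel p ?_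
      unfold weilConv
      exact hGi.integrable_convolution (ContinuousLinearMap.mul ℂ ℂ) (Theorems.PfPersistence.integrable_weilReflect hGi)
    have hkk : Integrable (twistKernel p (weilConv (weilConv G (moll k)) (weilReflect (weilConv G (moll k))))) :=
      integrable_twistKernel p (integrable_weilConv_weilReflect (isWeilTest_weilConv_moll_of_bdd hGm hM hGb k))
    have htri : ∫ τ, ‖twistKernel p (weilConv (weilConv G (moll k)) (weilReflect (weilConv G (moll k)))) τ‖
        ≤ (∫ τ, ‖twistKernel p (weilConv G (weilReflect G)) τ‖)
          + ∫ τ, ‖twistKernel p (weilConv (weilConv G (moll k)) (weilReflect (weilConv G (moll k)))) τ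
            - twistKernel p (weilConv G (weilReflect G)) τ‖ := by
      have n1 : Integrable (fun τ : ℝ ↦ ‖twistKernel p (weilConv G (weilReflect G)) τ‖) := hkG.norm
      have n2 : Integrable (fun τ : ℝ ↦
          ‖twistKernel p (weilConv (weilConv G (moll k)) (weilReflect (weilConv G (moll k)))) τ
            - twistKernel p (weilConv G (weilReflect G)) τ‖) := (hkk.sub hkG).norm
      rw [← integral_add n1 n2]
      refine integral_mono_of_nonneg (Eventually.of_forall fun _ ↦ norm_nonneg _)
        (n1.add n2) (Eventually.of_forall fun τ ↦ ?_)
      exact norm_le_norm_add_norm_sub' _ _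
    linarith
  -- (iii) the Weil side is eventually `≤ C`: hypothesis `hC`; (iv) the support is eventually inside `[−a, a]`
  have e4 : ∀ᶠ k : ℕ in atTop, b + (bump k).rOut ≤ a := by
    have h : Tendsto (fun k : ℕ ↦ b + (bump k).rOut) atTop (𝓝 (b + 0)) := tendsto_bump_rOut.const_add b
    rw [add_zero] at h
    exact h.eventually (Iic_mem_nhds hab)
  obtain ⟨k, ⟨hk1, hk2⟩, hk3, hk4⟩ := ((e1.and e2).and (hC.and e4)).exists
  -- the smooth test function `g_k`
  set g : ℝ → ℂ := weilConv G (moll k) with hg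
  have hgt : IsWeilTest g := isWeilTest_weilConv_moll_of_bdd hGm hM hGb k
  have hsupp : tsupport g ⊆ Icc (-a) a :=
    (tsupport_weilConv_moll_subset_of_bdd hGb k).trans (Icc_subset_Icc (by linarith) hk4)
  have hg1 : mulFourier g (I / 2) = 0 := mulFourier_weilConv_moll_eq_zero hGm hM hGb h1 k
  have hg0 : mulFourier g 0 = 0 := mulFourier_weilConv_moll_eq_zero hGm hM hGb h0 k
  -- the Sonin datum at `g_k`
  have hB' : B - s / 2 ≤ (soninTraceForm (twistKernel p (weilConv g (weilReflect g))) (η : ℝ → ℂ)).re := by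
    have h := (Complex.abs_re_le_norm _).trans hk1.le
    rw [Complex.sub_re] at h
    have h' := (abs_le.mp h).1
    linarith
  refine not_semilocalSoninIneqOn_of_near_vector p hgt hsupp hg1 hg0 hζ hd hdη hB' hG hN hk3 hC0 hk2 ?_
  rw [hs] at hs0
  linarith

/-- **The same, with the Sonin vector supplied by the distance lemma** from a band-energy bound `Λ` (hypothesis
`hband`; the tree's `SoninBandEnergy*` theorem gives `Λ = 0.9999428`), `∫_{[−1,1]}|𝓕η|² ≤ ε`, `ε/(1 − Λ) ≤ d²`,
`0 ≤ d < ‖η‖`. [folklore] -/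
theorem not_semilocalSoninIneqOn_of_bdd_witness_nearSonin {a : ℝ} (hGm : Measurable G) (hM : ∀ x, ‖G x‖ ≤ M)
    (hGb : ∀ x, b < |x| → G x = 0) (hb : 0 ≤ b) (hab : b < a) (hGc : ∀ᵐ x : ℝ, ContinuousAt G x)
    (h1 : mulFourier G (I / 2) = 0) (h0 : mulFourier G 0 = 0)
    {η : Lp ℂ 2 (volume : Measure ℝ)} (hev : η ∈ evenPart) (hvan : η ∈ vanishOn 1)
    {Λ : ℝ} (hΛ0 : 0 ≤ Λ) (hΛ1 : Λ < 1)
    (hband : ∀ f : Lp ℂ 2 (volume : Measure ℝ), (∀ᵐ x : ℝ, x ∉ Icc (-1 : ℝ) 1 → (f : ℝ → ℂ) x = 0) →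
      ∫ x in Icc (-1 : ℝ) 1, ‖((𝓕 f : Lp ℂ 2 (volume : Measure ℝ)) : ℝ → ℂ) x‖ ^ 2 ≤ Λ * ‖f‖ ^ 2)
    {ε d B Gm N C K : ℝ}
    (hε : ∫ x in Icc (-1 : ℝ) 1, ‖((𝓕 η : Lp ℂ 2 (volume : Measure ℝ)) : ℝ → ℂ) x‖ ^ 2 ≤ ε)
    (hdε : ε / (1 - Λ) ≤ d ^ 2) (hd0 : 0 ≤ d) (hdη : d < ‖η‖)
    (hB : B ≤ (soninTraceForm (twistKernel p (weilConv G (weilReflect G))) (η : ℝ → ℂ)).re)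
    (hG : ‖primeTwist p η‖ ^ 2 ≤ Gm) (hN : ‖η‖ ≤ N)
    (hC : ∀ᶠ k : ℕ in atTop, (archW (weilConv (weilConv G (moll k)) (weilReflect (weilConv G (moll k))))
      - weilSemilocalPrimeTerm {p} (weilConv (weilConv G (moll k)) (weilReflect (weilConv G (moll k))))).re ≤ C)
    (hC0 : 0 ≤ C)
    (hK : ∫ τ, ‖twistKernel p (weilConv G (weilReflect G)) τ‖ < K)
    (hineq : C * (Gm + 4 * ((2 * N + d) * d)) < B - K * ((2 * N + d) * d)) :
    ¬ SemilocalSoninIneqOn p a := by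
  obtain ⟨ζ, hζ, hest⟩ :=
    SoninDistance.exists_mem_soninSpace_norm_sub_sq_le (α := 1) (β := 1) hΛ0 hΛ1 hband η hev hvan
  have h1Λ : 0 < 1 - Λ := by linarith
  have hd : ‖η - ζ‖ ≤ d := by
    have hsq : ‖η - ζ‖ ^ 2 ≤ d ^ 2 :=
      hest.trans ((div_le_div_of_nonneg_right hε h1Λ.le).trans hdε)
    exact (pow_le_pow_iff_left₀ (norm_nonneg _) hd0 two_ne_zero).mp hsq
  exact not_semilocalSoninIneqOn_of_bdd_witness p hGm hM hGb hb hab hGc h1 h0 hζ hd hdη hB hG hN hC hC0 hK hineq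

end Limit

end Summit.RiemannHypothesis.RiemannHypothesis
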